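import Summits.CriticalPhenomena.PercolationContinuityZ3.Theorems.SahiMasterFamilySparseEndSystems

/-!
# The dense end of Sahi's hierarchy, III: trace families meeting only in the top — `Λ' = (s−1)!` for `s ≥ 3`, `Λ' = 1 − Z` for pairs

Support file of the master-family programme (crux `NoHeavyLowerTail`, stmt-CriticalPhenomena-4575; cell `prim-masterthm`, seat P4,
unit `prim-masterthm-p4-g5`).  Seat document HOME/prim-masterthm-p4/CORNERS.md §1, step (c) of Theorem D (the dense end).

At the dense end the relevant trace families on `2^c` (`c` a cheapest double failure) have the rigid property that any two of them meet
ONLY IN THE TOP configuration `c` ("pairwise traces `{c}`").  For such a family `G : Fin s → Finset (Finset ι)` (members `⊆ c`, up-closed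
inside `2^c`, `∅ ∉ G_i ∋ c`):

* `systems_eq_singleton_of_three_le` — for `s ≥ 3` the only admissible system of disjoint representatives is the constant one `γ ≡ c`,
  hence **`lambdaSys_eq_factorial_of_three_le`**: `Λ'(G, c) = (s − 1)!`;
* for pairs (`s = 2`): the non-constant systems are the SPLITS `c = a ⊔ b`, `a ∈ G_0`, `b ∈ G_1`; there is at most one
  (`card_ncSystems_le_one`), so **`lambdaSys_two_eq`**: `Λ'(G, c) = 1 − #splits ∈ {0, 1}`.
HONEST FRAMING: combinatorial lemmas towards the sign of the dense-end leading coefficient (Theorem D); no positivity claim about Sahi's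
`C_k` is made.  [this work]
-/

namespace Summit.CriticalPhenomena.PercolationContinuityZ3.Theorems

namespace SahiSparseEnd

open Finset Function SahiRepresentativeForm

variable {ι : Type*} [DecidableEq ι]

/-! ### Generalities -/

omit [DecidableEq ι] in
/-- `⋃_{i ∈ univ} c = c` over a nonempty index type. [folklore] -/
theorem biUnion_univ_const [DecidableEq ι] {s : ℕ} (hs : 1 ≤ s) (c : Finset ι) :
    (univ : Finset (Fin s)).biUnion (fun _ => c) = c := by
  ext x
  simp only [mem_biUnion, mem_univ, true_and]
  exact ⟨fun ⟨_, h⟩ => h, fun h => ⟨⟨0, hs⟩, h⟩⟩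

omit [DecidableEq ι] in
/-- `occ (const c) c = s`. [this work] -/
theorem occ_const [DecidableEq ι] {s : ℕ} (c : Finset ι) : occ (fun _ : Fin s => c) c = s := by
  rw [occ_eq_sum]
  simp

section Traces

variable {s : ℕ} {G : Fin s → Finset (Finset ι)} {c : Finset ι}
  (hsub : ∀ i a, a ∈ G i → a ⊆ c)
  (hup : ∀ i a a', a ∈ G i → a ⊆ a' → a' ⊆ c → a' ∈ G i)
  (hne : ∀ i, ∅ ∉ G i)
  (hc : ∀ i, c ∈ G i)
  (hpair : ∀ i j, i ≠ j → ∀ a, a ∈ G i → a ∈ G j → a = c)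

include hc in
/-- The constant system `γ ≡ c` is admissible (`s ≥ 1`). [this work] -/
theorem const_mem_systems (hs : 1 ≤ s) : (fun _ => c) ∈ systems G c :=
  mem_systems.2 ⟨fun i => hc i, fun _ _ => Or.inl rfl, biUnion_univ_const hs c⟩

include hsub hup hpair in
/-- In an admissible system of a family with pairwise traces `{c}`, a non-top representative is disjoint from every other
representative, and the union of two distinct non-top representatives is `c`. [this work] -/
theorem systems_aux {γ : Fin s → Finset ι} (hγ : γ ∈ systems G c) {i j : Fin s} (hij : i ≠ j) (hi : γ i ≠ c) :
    Disjoint (γ i) (γ j) ∧ (γ j ≠ c → γ i ∪ γ j = c) := by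
  obtain ⟨hF, hdis, -⟩ := mem_systems.1 hγ
  have hne' : γ i ≠ γ j := fun h => hi (hpair i j hij (γ i) (hF i) (h ▸ hF j))
  refine ⟨(hdis i j).resolve_left hne', fun hj => ?_⟩
  have hsubc : γ i ∪ γ j ⊆ c := union_subset (hsub i _ (hF i)) (hsub j _ (hF j))
  exact hpair i j hij _ (hup i _ _ (hF i) subset_union_left hsubc) (hup j _ _ (hF j) subset_union_right hsubc)

include hsub hup hne hc hpair in
/-- **For `s ≥ 3` the only admissible system is the constant one.** [this work] -/
theorem systems_eq_singleton_of_three_le (h3 : 3 ≤ s) : systems G c = {fun _ => c} := by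
  ext γ
  rw [mem_singleton]
  constructor
  · intro hγ
    obtain ⟨hF, hdis, -⟩ := mem_systems.1 hγ
    have hnz : ∀ i, γ i ≠ ∅ := fun i h => hne i (h ▸ hF i)
    by_contra hcon
    obtain ⟨i, hi⟩ : ∃ i, γ i ≠ c := by
      by_contra h
      exact hcon (funext fun i => not_not.1 fun hi => h ⟨i, hi⟩)
    -- every other representative is also different from `c` (it is disjoint from the nonempty `γ i ⊆ c`)
    have hother : ∀ j, j ≠ i → γ j ≠ c := by
      intro j hji hjc
      have hd := (systems_aux hsub hup hpair hγ (Ne.symm hji) hi).1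
      rw [hjc] at hd
      exact hnz i (disjoint_self.1 (hd.mono_right (hsub i _ (hF i))))
    -- pick `j ≠ i` and `l ∉ {i, j}`
    have hcard : ((univ : Finset (Fin s)).erase i).card = s - 1 := by
      rw [card_erase_of_mem (mem_univ i), card_univ, Fintype.card_fin]
    obtain ⟨j, hj⟩ : ((univ : Finset (Fin s)).erase i).Nonempty := card_pos.1 (by omega)
    have hji : j ≠ i := ne_of_mem_erase hj
    have hcard' : (((univ : Finset (Fin s)).erase i).erase j).card = s - 1 - 1 := by
      rw [card_erase_of_mem hj, hcard]
    obtain ⟨l, hl⟩ : (((univ : Finset (Fin s)).erase i).erase j).Nonempty := card_pos.1 (by omega)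
    have hlj : l ≠ j := ne_of_mem_erase hl
    have hli : l ≠ i := ne_of_mem_erase (mem_of_mem_erase hl)
    -- `γ i ∪ γ j = c` and `γ l` is disjoint from both: so `γ l = ∅`
    have hij := systems_aux hsub hup hpair hγ hji.symm hi
    have hunion : γ i ∪ γ j = c := hij.2 (hother j hji)
    have hdil : Disjoint (γ l) (γ i) := (systems_aux hsub hup hpair hγ hli (hother l hli)).1
    have hdjl : Disjoint (γ l) (γ j) := (systems_aux hsub hup hpair hγ hlj (hother l hli)).1
    have hsubl : γ l ⊆ γ i ∪ γ j := hunion ▸ hsub l _ (hF l)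
    refine hnz l (eq_empty_of_forall_notMem fun x hx => ?_)
    rcases mem_union.1 (hsubl hx) with h | h
    · exact disjoint_left.1 hdil hx h
    · exact disjoint_left.1 hdjl hx h
  · rintro rfl
    exact const_mem_systems hc (by omega)

include hsub hup hne hc hpair in
/-- **`Λ'(G, c) = (s − 1)!` for `s ≥ 3` events with pairwise traces `{c}`.** [this work] -/
theorem lambdaSys_eq_factorial_of_three_le (h3 : 3 ≤ s) : LambdaSys G c = ((s - 1).factorial : ℤ) := by
  have hne0 : (univ : Finset (Fin s)).Nonempty := ⟨⟨0, by omega⟩, mem_univ _⟩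
  rw [LambdaSys, systems_eq_singleton_of_three_le hsub hup hne hc hpair h3, sum_singleton, image_const hne0, card_singleton,
    prod_singleton, occ_const]
  norm_num

/-! ### Pairs: the non-constant systems are the splits, and there is at most one -/

/-- The non-constant admissible systems. [this work] -/
def ncSystems (G : Fin s → Finset (Finset ι)) (c : Finset ι) : Finset (Fin s → Finset ι) := (systems G c).erase fun _ => c

omit [DecidableEq ι] in
/-- `im γ = {γ 0, γ 1}` on `Fin 2`. [folklore] -/
theorem image_univ_fin_two [DecidableEq ι] (γ : Fin 2 → Finset ι) : (univ : Finset (Fin 2)).image γ = {γ 0, γ 1} := by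
  ext x
  simp only [mem_image, mem_univ, true_and, Fin.exists_fin_two, mem_insert, mem_singleton]
  constructor
  · rintro (h | h) <;> [exact Or.inl h.symm; exact Or.inr h.symm]
  · rintro (h | h) <;> [exact Or.inl h.symm; exact Or.inr h.symm]

include hpair in
/-- On two slots, a system with equal representatives is the constant one. [this work] -/
theorem eq_const_of_apply_eq (h2 : s = 2) {γ : Fin s → Finset ι} (hγ : γ ∈ systems G c)
    (heq : γ ⟨0, by omega⟩ = γ ⟨1, by omega⟩) : γ = fun _ => c := by
  subst h2
  obtain ⟨hF, -, -⟩ := mem_systems.1 hγ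
  have h0 : γ 0 = c := hpair 0 1 (by decide) _ (hF 0) (heq ▸ hF 1)
  funext m
  fin_cases m
  · exact h0
  · exact heq ▸ h0

include hsub hup hpair in
/-- **Uniqueness of the split** (`s = 2`): two non-constant admissible systems coincide. [this work] -/
theorem card_ncSystems_le_one (h2 : s = 2) : (ncSystems G c).card ≤ 1 := by
  subst h2
  refine card_le_one.2 fun γ hγ γ' hγ' => ?_
  rw [ncSystems, mem_erase] at hγ hγ'
  obtain ⟨hF, hdis, hun⟩ := mem_systems.1 hγ.2
  obtain ⟨hF', hdis', hun'⟩ := mem_systems.1 hγ'.2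
  have hne01 : γ 0 ≠ γ 1 := fun h => hγ.1 (eq_const_of_apply_eq hpair rfl hγ.2 h)
  have hne01' : γ' 0 ≠ γ' 1 := fun h => hγ'.1 (eq_const_of_apply_eq hpair rfl hγ'.2 h)
  have hd : Disjoint (γ 0) (γ 1) := (hdis 0 1).resolve_left hne01
  have hd' : Disjoint (γ' 0) (γ' 1) := (hdis' 0 1).resolve_left hne01'
  have hu : γ 0 ∪ γ 1 = c := by rw [← hun]; ext x; simp [Fin.exists_fin_two]
  have hu' : γ' 0 ∪ γ' 1 = c := by rw [← hun']; ext x; simp [Fin.exists_fin_two]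
  -- cross unions are `c`
  have hx : γ 0 ∪ γ' 1 = c := by
    have hsubc : γ 0 ∪ γ' 1 ⊆ c := union_subset (hsub 0 _ (hF 0)) (hsub 1 _ (hF' 1))
    exact hpair 0 1 (by decide) _ (hup 0 _ _ (hF 0) subset_union_left hsubc) (hup 1 _ _ (hF' 1) subset_union_right hsubc)
  have hx' : γ' 0 ∪ γ 1 = c := by
    have hsubc : γ' 0 ∪ γ 1 ⊆ c := union_subset (hsub 0 _ (hF' 0)) (hsub 1 _ (hF 1))
    exact hpair 0 1 (by decide) _ (hup 0 _ _ (hF' 0) subset_union_left hsubc) (hup 1 _ _ (hF 1) subset_union_right hsubc)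
  -- hence `γ 1 = γ' 1` and `γ 0 = γ' 0`
  have h1 : γ 1 = γ' 1 := by
    apply Subset.antisymm
    · intro x hx1
      have hxc : x ∈ c := hu ▸ mem_union_right _ hx1
      rcases mem_union.1 (hx'.symm ▸ hxc : x ∈ γ' 0 ∪ γ 1) with h | h
      · -- x ∈ γ' 0; also x ∉ γ 0 (disjoint from γ 1); from `γ 0 ∪ γ' 1 = c`, x ∈ γ' 1… contradiction with disjointness of γ' 0, γ' 1
        rcases mem_union.1 (hx.symm ▸ hxc : x ∈ γ 0 ∪ γ' 1) with h' | h'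
        · exact absurd hx1 (disjoint_left.1 hd h')
        · exact absurd h' (disjoint_left.1 hd' h)
      · rcases mem_union.1 (hx.symm ▸ hxc : x ∈ γ 0 ∪ γ' 1) with h' | h'
        · exact absurd hx1 (disjoint_left.1 hd h')
        · exact h'
    · intro x hx1
      have hxc : x ∈ c := hu' ▸ mem_union_right _ hx1
      rcases mem_union.1 (hx.symm ▸ hxc : x ∈ γ 0 ∪ γ' 1) with h | h
      · rcases mem_union.1 (hx'.symm ▸ hxc : x ∈ γ' 0 ∪ γ 1) with h' | h'
        · exact absurd hx1 (disjoint_left.1 hd' h')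
        · exact absurd h (disjoint_right.1 hd h')
      · rcases mem_union.1 (hx'.symm ▸ hxc : x ∈ γ' 0 ∪ γ 1) with h' | h'
        · exact absurd hx1 (disjoint_left.1 hd' h')
        · exact h'
  have h0 : γ 0 = γ' 0 := by
    apply Subset.antisymm
    · intro x hx0
      have hxc : x ∈ c := hu ▸ mem_union_left _ hx0
      rcases mem_union.1 (hu'.symm ▸ hxc : x ∈ γ' 0 ∪ γ' 1) with h | h
      · exact h
      · exact absurd (h1 ▸ h : x ∈ γ 1) (disjoint_left.1 hd hx0)
    · intro x hx0
      have hxc : x ∈ c := hu' ▸ mem_union_left _ hx0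
      rcases mem_union.1 (hu.symm ▸ hxc : x ∈ γ 0 ∪ γ 1) with h | h
      · exact h
      · exact absurd (h1.symm ▸ h : x ∈ γ' 1) (disjoint_left.1 hd' hx0)
  funext m
  fin_cases m
  · exact h0
  · exact h1

include hc hpair in
/-- **`Λ'(G, c) = 1 − #(non-constant systems)` for a pair** (`s = 2`). [this work] -/
theorem lambdaSys_two_eq (h2 : s = 2) : LambdaSys G c = 1 - ((ncSystems G c).card : ℤ) := by
  subst h2
  have hconst : (fun _ => c) ∈ systems G c := const_mem_systems hc (by omega)
  rw [LambdaSys, ← add_sum_erase _ _ hconst]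
  have hne0 : (univ : Finset (Fin 2)).Nonempty := ⟨0, mem_univ _⟩
  rw [image_const hne0, card_singleton, prod_singleton, occ_const]
  have hw : ∀ γ ∈ ncSystems G c,
      (-1 : ℤ) ^ ((univ.image γ).card + 1) * ∏ a ∈ univ.image γ, (((occ γ a - 1).factorial : ℕ) : ℤ) = -1 := by
    intro γ hγ
    rw [ncSystems, mem_erase] at hγ
    have hne01 : γ 0 ≠ γ 1 := fun h => hγ.1 (eq_const_of_apply_eq hpair rfl hγ.2 h)
    have hocc0 : occ γ (γ 0) = 1 := by rw [occ_eq_sum, Fin.sum_univ_two]; simp [hne01.symm]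
    have hocc1 : occ γ (γ 1) = 1 := by rw [occ_eq_sum, Fin.sum_univ_two]; simp [hne01]
    rw [image_univ_fin_two, card_pair hne01, prod_pair hne01, hocc0, hocc1]
    norm_num
  rw [show (systems G c).erase (fun _ => c) = ncSystems G c from rfl, sum_congr rfl hw, sum_const, nsmul_eq_mul]
  norm_num
  ring

include hsub hup hc hpair in
/-- Hence `Λ'(G, c) ∈ {0, 1}` for a pair with traces meeting only in `c`: `0 ≤ Λ' ≤ 1`, and `Λ' = 0` iff a split exists. [this work] -/
theorem lambdaSys_two_nonneg (h2 : s = 2) : 0 ≤ LambdaSys G c := by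
  rw [lambdaSys_two_eq hc hpair h2]
  have := card_ncSystems_le_one hsub hup hpair h2
  omega

end Traces

end SahiSparseEnd

end Summit.CriticalPhenomena.PercolationContinuityZ3.Theorems
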